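import Literature.Probability.Percolation.ArmSeparationSlotSep
import HarnessLib

/-!
# Slot events: the supports are pairwise disjoint

Topic: Probability / Percolation; family `crit-perc`. A brick of the discharge of
`Literature.Probability.Percolation.Nolin2008_twoArm_separation` (Nolin 2008, Thm. 11
[arXiv 0711.4948: Thm. 10]; `ArmSeparation.lean`), landing step of the internal extremities
(Nolin 2008, Prop. 12 and Lemma 13 [arXiv Prop. 11, Lemma 12]: the supports `𝒜`, `𝒜⁺`, `𝒜⁻` of
the generalised FKG inequality must be pairwise disjoint). Assembly of the piecewise separation
lemmas of `ArmSeparationSlotSep.lean`: for a valid rung and a slot in range, admissible and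
separated, `Pfin σ` and `Mfin σ` are disjoint (`Slot.disjoint_Pfin_Mfin` (with at least one fence scale, `1 ≤ K`, so that `μ ≥ 32 k₀`), nine pairs of pieces),
and both are disjoint from the shared support `sharedFin m R` (`Slot.disjoint_shared`: every
private site lies in `Λ̊_m`).

## References

* P. Nolin, *Near-critical percolation in two dimensions*, Electron. J. Probab. 13 (2008), §4.3
  Prop. 12, Lemma 13, §4.4 [arXiv 0711.4948: Prop. 11, Lemma 12, Thm. 10]. [Nolin2008]
-/

noncomputable section

open Set

namespace Literature.Probability.Percolation

open LatticeModels HalfAnnulus Tube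

/-! ### Integer facts of a valid rung and a slot -/

namespace Slot

variable {P : LParams} {σ : Slot}

/-- **The integer facts** of a valid rung and a slot in range, admissible — subtraction-free and
cast to `ℤ`, so that linear arithmetic runs without case splits. [folklore] -/
theorem ifacts (hV : P.Valid) (hσ : σ.InRange P) (hadm : σ.Admissible P) :
    ((P.s : ℤ) = P.k₀ ∧ 64 ≤ (P.k₀ : ℤ) ∧ (P.k₀ : ℤ) ≤ P.μ ∧ 4 * (P.w : ℤ) ≤ P.k₀ ∧ (P.k₀ : ℤ) ≤ 4 * P.w + 3 ∧
      4 * (P.e : ℤ) ≤ P.k₀ ∧ (P.k₀ : ℤ) ≤ 4 * P.e + 3 ∧ 16 * (P.ε : ℤ) ≤ P.k₀ ∧ (P.k₀ : ℤ) ≤ 16 * P.ε + 15) ∧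
    ((P.rB : ℤ) + P.μ ≤ P.m ∧ (P.m : ℤ) < P.rB + P.s + P.μ ∧ (P.rW : ℤ) + 3 * P.μ ≤ P.m ∧ (P.m : ℤ) < P.rW + P.s + 3 * P.μ ∧
      (P.m : ℤ) = 2 * P.n + 1 ∧ 2 * (P.m : ℤ) ≤ P.N ∧ 128 ≤ (P.n : ℤ) ∧ 64 * (P.μ : ℤ) ≤ P.n ∧ 8 * (P.μ : ℤ) ≤ P.R₀ ∧
      4 * (P.R₀ : ℤ) ≤ P.n) ∧
    ((P.k₀ : ℤ) ≤ σ.ko P ∧ 32 * (σ.ko P : ℤ) ≤ P.μ ∧ (P.k₀ : ℤ) ≤ σ.kc P ∧ 32 * (σ.kc P : ℤ) ≤ P.μ ∧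
      (P.LB : ℤ) = P.μ + 2 * P.s + 4 * P.e ∧ (P.LW : ℤ) = 3 * P.μ + 2 * P.s + 4 * P.e ∧
      (P.n : ℤ) - (P.n / 8 : ℕ) + 1 + P.WB = P.rB + 2 * P.e ∧ (P.n : ℤ) - (P.n / 8 : ℕ) + 1 + P.WW = P.rW + 2 * P.e) ∧
    (8 * ((P.n / 8 : ℕ) : ℤ) ≤ P.n ∧ (P.n : ℤ) ≤ 8 * (P.n / 8 : ℕ) + 7 ∧ 4 * ((P.n / 4 : ℕ) : ℤ) ≤ P.n ∧
      (P.n : ℤ) ≤ 4 * (P.n / 4 : ℕ) + 3 ∧ 64 * ((P.n / 64 : ℕ) : ℤ) ≤ P.n ∧ (P.n : ℤ) ≤ 64 * (P.n / 64 : ℕ) + 63) ∧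
    (σ.To P ≤ -(P.R₀ : ℤ) ∧ -(P.m : ℤ) + P.R₀ < σ.To P + P.w ∧ σ.Tc P ≤ -(P.R₀ : ℤ) ∧ -(P.m : ℤ) + P.R₀ < σ.Tc P + P.w ∧
      σ.ξo P = σ.To P + 2 * σ.ko P + P.w ∧ σ.ξc P = σ.Tc P + 2 * σ.kc P + P.w ∧
      -(P.n : ℤ) + (P.n / 4 : ℕ) ≤ σ.tgo P ∧ σ.tgo P ≤ -((P.n / 4 : ℕ) : ℤ) ∧
      -(P.n : ℤ) + (P.n / 4 : ℕ) ≤ σ.tgc P ∧ σ.tgc P ≤ -((P.n / 4 : ℕ) : ℤ)) := by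
  obtain ⟨hs, hw, he, hε, hk₀, hkμ, hrB, hrB', hrW, hrW', hnB, hnW, hm, hN, hn, hμn, hR₀, hR₀n⟩ := hV.facts
  have hko1 : P.k₀ ≤ σ.ko P := le_trapScale _ _
  have hko2 : 32 * σ.ko P ≤ P.μ := P.scale_le hσ.hjo
  have hkc1 : P.k₀ ≤ σ.kc P := le_trapScale _ _
  have hkc2 : 32 * σ.kc P ≤ P.μ := P.scale_le hσ.hjc
  obtain ⟨ha1, ha2, ha3, ha4⟩ := hadm
  have htgo := tgtRow_mem (n := P.n) (σ.bo P)
  have htgc := tgtRow_mem (n := P.n) (σ.bc P)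
  have hμm : P.μ ≤ P.m := by omega
  have hμm3 : 3 * P.μ ≤ P.m := by omega
  refine ⟨⟨by rw [hs], by exact_mod_cast hk₀, by exact_mod_cast hkμ, ?_, ?_, ?_, ?_, ?_, ?_⟩, ⟨?_, ?_, ?_, ?_, by exact_mod_cast hm,
    by exact_mod_cast hN, by exact_mod_cast hn, by exact_mod_cast hμn, by exact_mod_cast hR₀, by exact_mod_cast hR₀n⟩,
    ⟨by exact_mod_cast hko1, by exact_mod_cast hko2, by exact_mod_cast hkc1, by exact_mod_cast hkc2,
      by unfold LParams.LB; push_cast; ring, by unfold LParams.LW; push_cast; ring, ?_, ?_⟩,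
    ⟨?_, ?_, ?_, ?_, ?_, ?_⟩, ⟨ha1, ha2, ha3, ha4, rfl, rfl, htgo.1, htgo.2, htgc.1, htgc.2⟩⟩
  · rw [hw]; exact_mod_cast Nat.mul_div_le P.k₀ 4
  · rw [hw]; have := Nat.lt_div_mul_add (a := P.k₀) (b := 4) (by norm_num); push_cast; omega
  · rw [he]; exact_mod_cast Nat.mul_div_le P.k₀ 4
  · rw [he]; have := Nat.lt_div_mul_add (a := P.k₀) (b := 4) (by norm_num); push_cast; omega
  · rw [hε]; exact_mod_cast Nat.mul_div_le P.k₀ 16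
  · rw [hε]; have := Nat.lt_div_mul_add (a := P.k₀) (b := 16) (by norm_num); push_cast; omega
  · have : P.rB + P.μ ≤ P.m := by omega
    exact_mod_cast this
  · have : P.m < P.rB + P.s + P.μ := by omega
    exact_mod_cast this
  · have : P.rW + 3 * P.μ ≤ P.m := by omega
    exact_mod_cast this
  · have : P.m < P.rW + P.s + 3 * P.μ := by omega
    exact_mod_cast this
  · have : P.n + 1 ≤ P.rB + 2 * P.e + P.n / 8 := by omega
    unfold LParams.WB; omega
  · have : P.n + 1 ≤ P.rW + 2 * P.e + P.n / 8 := by omega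
    unfold LParams.WW; omega
  · exact_mod_cast Nat.mul_div_le P.n 8
  · have := Nat.lt_div_mul_add (a := P.n) (b := 8) (by norm_num); push_cast; omega
  · exact_mod_cast Nat.mul_div_le P.n 4
  · have := Nat.lt_div_mul_add (a := P.n) (b := 4) (by norm_num); push_cast; omega
  · exact_mod_cast Nat.mul_div_le P.n 64
  · have := Nat.lt_div_mul_add (a := P.n) (b := 64) (by norm_num); push_cast; omega

/-- With at least one fence scale, `32 k₀ ≤ μ`. [folklore] -/
theorem mu_ge (hK : 1 ≤ P.K) : 32 * (P.k₀ : ℤ) ≤ P.μ := by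
  have : 32 * P.k₀ ≤ P.μ := by
    show 32 * P.k₀ ≤ trapScale P.k₀ P.K
    unfold trapScale
    calc 32 * P.k₀ = P.k₀ * 32 ^ 1 := by ring
      _ ≤ P.k₀ * 32 ^ P.K := Nat.mul_le_mul_left _ (Nat.pow_le_pow_right (by norm_num) hK)
  exact_mod_cast this

/-! ### Norms of the pieces -/

/-- Norm bound of the near set: `m - 2k + 1 - L ≤ |v| ≤ m - 1`. [folklore] -/
theorem norm_of_mem_nearSet {i m k : ℕ} {T₀ : ℤ} {w L ε R₀ : ℕ} (hi : i < 6) (hk : 1 ≤ k) (hε : ε ≤ k)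
    (hL : 3 * k + 1 ≤ L) (hL' : (L : ℤ) + 2 * k ≤ m) (hadm : T₀ ≤ -(R₀ : ℤ) ∧ -(m : ℤ) + R₀ < T₀ + w) (hR : (w : ℤ) + 4 * k ≤ R₀)
    {v : Site 2} (hv : v ∈ nearSet i m k T₀ w L ε) : (m : ℤ) - 2 * k + 1 - L ≤ triNorm v ∧ triNorm v ≤ (m : ℤ) - 1 := by
  obtain ⟨u, rfl, h0, h0', h1, h1'⟩ := exists_of_mem_nearSet hk hε hL hv
  rw [triNorm_frameIso i hi]
  exact ⟨le_triNorm_iff_lin.2 (Or.inl h0), triNorm_le_iff_lin.2 (by omega)⟩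

/-- Norm bound of the target set: `|v| ≤ n - n/8 + 1 + W` (`16 ≤ n`, `n/8 ≤ W`, rows in `[-n + n/4, -n/4]`). [folklore] -/
theorem norm_of_mem_tgtSet {n : ℕ} {t : ℤ} {W : ℕ} (hn : 16 ≤ n) (hW : n / 8 ≤ W)
    (ht : -(n : ℤ) + (n / 4 : ℕ) ≤ t ∧ t ≤ -((n / 4 : ℕ) : ℤ)) {v : Site 2} (hv : v ∈ tgtSet n t W) :
    triNorm v ≤ (n : ℤ) - (n / 8 : ℕ) + 1 + W ∧ 0 < v 0 := by
  obtain ⟨h0, h0', h1, h1'⟩ := bounds_of_mem_tgtSet hn hW hv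
  have hW' : ((n / 8 : ℕ) : ℤ) ≤ W := by exact_mod_cast hW
  exact ⟨triNorm_le_iff_lin.2 (by omega), by omega⟩

/-- Norms of the black near set. [folklore] -/
theorem norm_blackNear (hV : P.Valid) (hσ : σ.InRange P) (hadm : σ.Admissible P) {x : Site 2}
    (hx : x ∈ nearSet σ.io P.m (σ.ko P) (σ.To P) P.w P.LB P.ε) :
    (P.m : ℤ) - 2 * σ.ko P + 1 - P.LB ≤ triNorm x ∧ triNorm x ≤ (P.m : ℤ) - 1 := by
  obtain ⟨⟨hs, hk₀, hkμ, hw1, hw2, he1, he2, hε1, hε2⟩, ⟨hrB1, hrB2, hrW1, hrW2, hm, hN, hn, hμn, hR₀, hR₀n⟩,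
    ⟨hko1, hko2, hkc1, hkc2, hLB, hLW, hWB, hWW⟩, -, ⟨ha1, ha2, ha3, ha4, hξo, hξc, -, -, -, -⟩⟩ := ifacts hV hσ hadm
  exact norm_of_mem_nearSet (R₀ := P.R₀) hσ.hio (by omega) (by omega) (by omega) (by omega) ⟨ha1, ha2⟩ (by omega) hx

/-- Norms of the white near set (colour-exchanged frame). [folklore] -/
theorem norm_whiteNear (hV : P.Valid) (hσ : σ.InRange P) (hadm : σ.Admissible P) {x : Site 2}
    (hx : x ∈ nearSet σ.ic' P.m (σ.kc P) (σ.Tc P) P.w P.LW P.ε) :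
    (P.m : ℤ) - 2 * σ.kc P + 1 - P.LW ≤ triNorm x ∧ triNorm x ≤ (P.m : ℤ) - 1 := by
  obtain ⟨⟨hs, hk₀, hkμ, hw1, hw2, he1, he2, hε1, hε2⟩, ⟨hrB1, hrB2, hrW1, hrW2, hm, hN, hn, hμn, hR₀, hR₀n⟩,
    ⟨hko1, hko2, hkc1, hkc2, hLB, hLW, hWB, hWW⟩, -, ⟨ha1, ha2, ha3, ha4, hξo, hξc, -, -, -, -⟩⟩ := ifacts hV hσ hadm
  exact norm_of_mem_nearSet (R₀ := P.R₀) (Nat.mod_lt _ (by norm_num)) (by omega) (by omega) (by omega) (by omega) ⟨ha3, ha4⟩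
    (by omega) hx

/-- Norms of the black arc. [folklore] -/
theorem norm_blackArc (hV : P.Valid) (hσ : σ.InRange P) (hadm : σ.Admissible P) {x : Site 2}
    (hx : x ∈ boxAll (arc (thinRing P.rB P.e P.s) (σ.aB P) P.lenB)) :
    (P.rB : ℤ) - P.s - 2 * P.e ≤ triNorm x ∧ triNorm x ≤ (P.rB : ℤ) + 2 * P.e := by
  obtain ⟨⟨hs, hk₀, hkμ, hw1, hw2, he1, he2, hε1, hε2⟩, ⟨hrB1, hrB2, hrW1, hrW2, hm, hN, hn, hμn, hR₀, hR₀n⟩, -, -, -⟩ :=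
    ifacts hV hσ hadm
  obtain ⟨T, hT, hx⟩ := hx
  exact triNorm_mem_of_mem_thinRing (by omega) (mem_of_mem_arc hT) hx

/-- Norms of the white arc. [folklore] -/
theorem norm_whiteArc (hV : P.Valid) (hσ : σ.InRange P) (hadm : σ.Admissible P) {x : Site 2}
    (hx : x ∈ boxAll (arc (thinRing P.rW P.e P.s) (σ.aW P) (σ.lenW P))) :
    (P.rW : ℤ) - P.s - 2 * P.e ≤ triNorm x ∧ triNorm x ≤ (P.rW : ℤ) + 2 * P.e := by
  obtain ⟨⟨hs, hk₀, hkμ, hw1, hw2, he1, he2, hε1, hε2⟩, ⟨hrB1, hrB2, hrW1, hrW2, hm, hN, hn, hμn, hR₀, hR₀n⟩, -, -, -⟩ :=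
    ifacts hV hσ hadm
  obtain ⟨T, hT, hx⟩ := hx
  exact triNorm_mem_of_mem_thinRing (by omega) (mem_of_mem_arc hT) hx

/-- Norms of the black target set. [folklore] -/
theorem norm_blackTgt (hV : P.Valid) (hσ : σ.InRange P) (hadm : σ.Admissible P) {x : Site 2}
    (hx : x ∈ tgtSet P.n (σ.tgo P) P.WB) : triNorm x ≤ (P.rB : ℤ) + 2 * P.e ∧ 0 < x 0 := by
  obtain ⟨⟨hs, hk₀, hkμ, -, -, he1, he2, -, -⟩, ⟨hrB1, hrB2, -, -, hm, -, hn, hμn, -, -⟩, ⟨-, -, -, -, -, -, hWB, -⟩, -,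
    ⟨-, -, -, -, -, -, ht1, ht2, -, -⟩⟩ := ifacts hV hσ hadm
  -- the target row is a decision-laden atom: replace it by a variable before any arithmetic
  generalize σ.tgo P = tg at hx ht1 ht2
  have f1 : 16 ≤ P.n := by clear * - hn; omega
  have f2 : P.n / 8 ≤ P.WB := by clear * - hWB hrB2 hm hμn hs hkμ; omega
  have := norm_of_mem_tgtSet f1 f2 ⟨ht1, ht2⟩ hx
  rw [hWB] at this; exact this

/-- Norms of the white target set. [folklore] -/
theorem norm_whiteTgt (hV : P.Valid) (hσ : σ.InRange P) (hadm : σ.Admissible P) {x : Site 2}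
    (hx : x ∈ tgtSet P.n (σ.tgc P) P.WW) : triNorm x ≤ (P.rW : ℤ) + 2 * P.e ∧ 0 < x 0 := by
  obtain ⟨⟨hs, hk₀, hkμ, -, -, he1, he2, -, -⟩, ⟨-, -, hrW1, hrW2, hm, -, hn, hμn, -, -⟩, ⟨-, -, -, -, -, -, -, hWW⟩, -,
    ⟨-, -, -, -, -, -, -, -, ht1, ht2⟩⟩ := ifacts hV hσ hadm
  generalize σ.tgc P = tg at hx ht1 ht2
  have f1 : 16 ≤ P.n := by clear * - hn; omega
  have f2 : P.n / 8 ≤ P.WW := by clear * - hWW hrW2 hm hμn hs hkμ; omega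
  have := norm_of_mem_tgtSet f1 f2 ⟨ht1, ht2⟩ hx
  rw [hWW] at this; exact this

/-- The white near set is `frameIso ic` of the slot frame box and the spoke's box. [folklore] -/
theorem eq_frameIso_of_neg {hic : σ.ic < 6} {x : Site 2} {v : Site 2} (hxv : frameIso σ.ic' x = -v) : v = frameIso σ.ic x := by
  have := frameIso_add_three hic x
  rw [show (σ.ic + 3) % 6 = σ.ic' from rfl] at this
  rw [this] at hxv; exact (neg_injective hxv).symm

/-! ### The nine pairs -/

/-- Near / near. [folklore] -/
theorem sep_near_near (hV : P.Valid) (hσ : σ.InRange P) (hadm : σ.Admissible P) (hsep : σ.SepOK P) {v : Site 2}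
    (hvP : v ∈ nearSet σ.io P.m (σ.ko P) (σ.To P) P.w P.LB P.ε) (hu : -v ∈ nearSet σ.ic' P.m (σ.kc P) (σ.Tc P) P.w P.LW P.ε) :
    False := by
  obtain ⟨⟨hs, hk₀, hkμ, hw1, hw2, he1, he2, hε1, hε2⟩, ⟨hrB1, hrB2, hrW1, hrW2, hm, hN, hn, hμn, hR₀, hR₀n⟩,
    ⟨hko1, hko2, hkc1, hkc2, hLB, hLW, hWB, hWW⟩, -, ⟨ha1, ha2, ha3, ha4, -, -, -, -, -, -⟩⟩ := ifacts hV hσ hadm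
  have hu' : v ∈ nearSet σ.ic P.m (σ.kc P) (σ.Tc P) P.w P.LW P.ε := by
    obtain ⟨x, hx, hxv⟩ := hu
    exact ⟨x, hx, (eq_frameIso_of_neg (hic := hσ.hic) hxv).symm⟩
  exact nearSet_disjoint_nearSet (R₀ := P.R₀) hσ.hio hσ.hic (by omega) (by omega) (by omega) (by omega) (by omega) (by omega)
    ⟨ha1, ha2, ha3, ha4⟩ (by omega) ⟨by omega, by omega⟩ hsep hvP hu'

/-- Arc B / near W. [folklore] -/
theorem sep_arcB_nearW (hV : P.Valid) (hσ : σ.InRange P) (hadm : σ.Admissible P) {v : Site 2}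
    (hvP : v ∈ boxAll (arc (thinRing P.rB P.e P.s) (σ.aB P) P.lenB))
    (hu : -v ∈ nearSet σ.ic' P.m (σ.kc P) (σ.Tc P) P.w P.LW P.ε) : False := by
  obtain ⟨⟨hs, hk₀, hkμ, hw1, hw2, he1, he2, hε1, hε2⟩, ⟨hrB1, hrB2, hrW1, hrW2, hm, hN, hn, hμn, hR₀, hR₀n⟩,
    ⟨hko1, hko2, hkc1, hkc2, hLB, hLW, hWB, hWW⟩, -, ⟨ha1, ha2, ha3, ha4, -, hξc, -, -, -, -⟩⟩ := ifacts hV hσ hadm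
  obtain ⟨-, -, -, -, -, -, -, -, -, -, hnB, -, -, -, -, -, -, -⟩ := hV.facts
  obtain ⟨T, hT, hvT⟩ := hvP
  obtain ⟨x, hx, hxv⟩ := hu
  have hxv' : v = frameIso σ.ic x := eq_frameIso_of_neg (hic := hσ.hic) hxv
  rcases hx with hx | hx
  · -- slot frame box: depth ≤ 5 kc, above the ring
    rw [Finset.mem_coe, mem_slotFrame (by omega)] at hx
    have h1 := triNorm_mem_of_mem_thinRing (by omega) (mem_of_mem_arc hT) hvT
    rw [hxv', triNorm_frameIso σ.ic hσ.hic] at h1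
    have := le_triNorm_iff_lin.2 (Or.inl hx.1 : (P.m : ℤ) - 5 * σ.kc P ≤ x 0 ∨ _)
    omega
  · -- spoke: the window
    obtain ⟨hι1, hι2, hnB1, -, hhi, -, hhi'', hξ1, hξ2⟩ := windowB_facts hV hσ hadm
    have hlen : (thinRing P.rB P.e P.s).length = 12 * P.nB - 4 := by rw [length_thinRing hnB1]; rfl
    obtain ⟨g, hg, hgout, hgT⟩ := mem_arc_compl (L := thinRing P.rB P.e P.s) (lo := σ.loB P) (hi := σ.hiB P)
      (by omega) (by rw [hlen]; exact hhi'') (by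
        have hl : P.lenB = (thinRing P.rB P.e P.s).length - (σ.hiB P - σ.loB P + 1) := by
          rw [hlen]; unfold LParams.lenB; omega
        rw [← hl]; exact hT)
    rw [hlen] at hg
    rw [getElem?_thinRing hnB1 hg, Option.some.injEq] at hgT
    subst hgT
    exact ringTube_disjoint_spoke (ic := σ.ic) (ιc := σ.ιc P) hnB1 ⟨_, by rw [← hnB, mul_comm]⟩ (by omega) hg hσ.hic (by omega)
      (le_trans (Nat.add_le_add_left (by norm_num) _) hι2)
      (by unfold Slot.hiB Slot.loB at hgout; exact hgout) (by rw [hξc] at hξ1 hξ2; exact ⟨hξ1, hξ2⟩) (by omega)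
      (lam := (P.R₀ : ℤ) - P.LW - 2 * σ.kc P - P.w - P.ε) (by omega) (by omega) (by omega) hvT ⟨x, hx, hxv'.symm⟩

/-- Target B / near W, with the target row `tg` of the open arm as a parameter, safe from the
closed tip when that tip sits on the side `0`. [folklore] -/
theorem sep_tgtB_nearW_aux (hV : P.Valid) (hσ : σ.InRange P) (hadm : σ.Admissible P) {v : Site 2} {tg : ℤ}
    (hvP : v ∈ tgtSet P.n tg P.WB) (hu : -v ∈ nearSet σ.ic' P.m (σ.kc P) (σ.Tc P) P.w P.LW P.ε)
    (htg : -(P.n : ℤ) + (P.n / 4 : ℕ) ≤ tg ∧ tg ≤ -((P.n / 4 : ℕ) : ℤ))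
    (hsafe : σ.ic = 0 → tg + (P.n / 64 : ℕ) < σ.Tc P + 1 ∨ σ.Tc P + P.w + 4 * σ.kc P < tg - (P.n / 64 : ℕ)) : False := by
  obtain ⟨⟨hs, hk₀, hkμ, hw1, hw2, he1, he2, hε1, hε2⟩, ⟨hrB1, hrB2, hrW1, hrW2, hm, hN, hn, hμn, hR₀, hR₀n⟩,
    ⟨hko1, hko2, hkc1, hkc2, hLB, hLW, hWB, hWW⟩, ⟨h81, h82, h41, h42, h641, h642⟩, ⟨ha1, ha2, ha3, ha4, -, hξc, -, -, -, -⟩⟩ :=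
    ifacts hV hσ hadm
  -- arithmetic side conditions; the set-membership hypotheses are cleared from the arithmetic context (speed)
  -- (`omega` is run on small contexts only: its exact elimination blows up on the full fact list)
  have f1 : 16 ≤ P.n := by clear * - hn; omega
  have f2 : P.n / 8 ≤ P.WB := by clear * - hWB hrB2 hm hμn hs hkμ; omega
  have f3 : 1 ≤ σ.kc P := by clear * - hkc1 hk₀; omega
  have f4 : P.ε ≤ σ.kc P := by clear * - hε1 hkc1; omega
  have f5 : 3 * σ.kc P + 1 ≤ P.LW := by clear * - hLW hkc2 hs hk₀; omega
  have f6 : (P.LW : ℤ) + 4 * σ.kc P + P.w < P.R₀ + ((P.n / 4 : ℕ) : ℤ) - (P.n / 8 : ℕ) - (P.n / 64 : ℕ) := by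
    clear * - hLW hkc2 hw1 hkμ hR₀ hμn hn hs he1 hk₀; omega
  obtain ⟨x, hx, hxv⟩ := hu
  have hxv' : v = frameIso σ.ic x := eq_frameIso_of_neg (hic := hσ.hic) hxv
  by_cases hic0 : σ.ic = 0
  · -- same side as the target
    obtain ⟨-, -, h1, h1'⟩ := bounds_of_mem_tgtSet f1 f2 hvP
    have hrows : σ.Tc P + 1 ≤ x 1 ∧ x 1 ≤ σ.Tc P + P.w + 4 * σ.kc P := by
      rcases hx with hx | hx
      · rw [Finset.mem_coe, mem_slotFrame f3] at hx; exact ⟨hx.2.2.1, hx.2.2.2⟩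
      · rw [Tube.mem_box] at hx
        simp only [spokeTube, bcnCentre, site_mk_apply_zero, site_mk_apply_one] at hx
        clear * - hx f4 hε2 hk₀ hkc1
        omega
    have hv1 : v 1 = x 1 := by rw [hxv', hic0]; exact (frameIso_apply_formula x).2.1
    have hs' := hsafe hic0
    clear * - h1 h1' hrows hv1 hs'
    omega
  · exact tgtSet_disjoint_nearSet_of_ne (R₀ := P.R₀) hσ.hic hic0 f1 f2 htg f3 f4 f5 ⟨ha3, ha4⟩ f6 hvP ⟨x, hx, hxv'.symm⟩

/-- Target B / near W: the danger zone makes the target row safe. [folklore] -/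
theorem sep_tgtB_nearW (hV : P.Valid) (hσ : σ.InRange P) (hadm : σ.Admissible P) {v : Site 2}
    (hvP : v ∈ tgtSet P.n (σ.tgo P) P.WB) (hu : -v ∈ nearSet σ.ic' P.m (σ.kc P) (σ.Tc P) P.w P.LW P.ε) : False := by
  have hsafe : σ.ic = 0 → σ.tgo P + (P.n / 64 : ℕ) < σ.Tc P + 1 ∨ σ.Tc P + P.w + 4 * σ.kc P < σ.tgo P - (P.n / 64 : ℕ) := by
    intro hic0
    obtain ⟨⟨hs, hk₀, hkμ, hw1, hw2, he1, he2, hε1, hε2⟩, ⟨-, -, -, -, hm, -, hn, hμn, -, -⟩,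
      ⟨hko1, hko2, hkc1, hkc2, -, -, -, -⟩, ⟨h81, h82, h41, h42, h641, h642⟩, ⟨-, -, -, -, -, hξc, -, -, -, -⟩⟩ := ifacts hV hσ hadm
    have hDdef : σ.bo P = !decide (σ.ic = 0 ∧ Danger P (σ.ξc P)) := rfl
    have htgdef : σ.tgo P = tgtRow P.n (σ.bo P) := rfl
    clear hvP hu
    by_cases hD : Danger P (σ.ξc P)
    · have hbo : σ.bo P = false := by rw [hDdef, hic0]; simp [hD]
      rw [hbo] at htgdef
      unfold Danger at hD
      simp only [tgtRow, cond_false, cond_true] at htgdef hD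
      clear hDdef hbo
      generalize σ.tgo P = tg at htgdef ⊢
      generalize σ.ξc P = xc at hD hξc
      clear * - htgdef hD hξc hkc2 hw1 hkμ hμn hn hs hk₀
      omega
    · have hbo : σ.bo P = true := by rw [hDdef]; simp [hD]
      rw [hbo] at htgdef
      unfold Danger at hD
      simp only [tgtRow, cond_true] at htgdef hD
      clear hDdef hbo
      generalize σ.tgo P = tg at htgdef ⊢
      generalize σ.ξc P = xc at hD hξc
      clear * - htgdef hD hξc hkc2 hw1 hkμ hμn hn hs hk₀
      omega
  obtain ⟨-, -, -, -, ⟨-, -, -, -, -, -, ht1, ht2, -, -⟩⟩ := ifacts hV hσ hadm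
  generalize σ.tgo P = tg at hvP ht1 ht2 hsafe
  exact sep_tgtB_nearW_aux hV hσ hadm hvP hu ⟨ht1, ht2⟩ hsafe

/-- Target B / arc W. [folklore] -/
theorem sep_tgtB_arcW (hV : P.Valid) (hσ : σ.InRange P) (hadm : σ.Admissible P) {v : Site 2}
    (hvP : v ∈ tgtSet P.n (σ.tgo P) P.WB) (hu : -v ∈ boxAll (arc (thinRing P.rW P.e P.s) (σ.aW P) (σ.lenW P))) : False := by
  obtain ⟨T, hT, huT⟩ := hu
  obtain ⟨hnW1, hlohi, hhi, -, -, -, -, -, -⟩ := windowW_facts (σ := σ) hV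
  have hlen : (thinRing P.rW P.e P.s).length = 12 * P.nW - 4 := by rw [length_thinRing hnW1]; rfl
  obtain ⟨g, hg, hgout, hgT⟩ := mem_arc_compl (L := thinRing P.rW P.e P.s) (lo := σ.loW P) (hi := σ.hiW P)
    hlohi (by rw [hlen]; exact hhi) (by rw [hlen]; exact hT)
  rw [hlen] at hg
  rw [getElem?_thinRing hnW1 hg, Option.some.injEq] at hgT
  subst hgT
  have hout : g < blockOff (P.rW / P.s) 3 + 2 * (latIdx P.s P.rW (σ.tgo P - (P.n / 64 : ℕ)) - 1) ∨
      blockOff (P.rW / P.s) 3 + 2 * (latIdx P.s P.rW (σ.tgo P + (P.n / 64 : ℕ)) + 1) + 1 < g := by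
    unfold Slot.hiW Slot.loW Slot.yLo Slot.yHi at hgout; exact hgout
  clear hgout hlohi hhi hT
  obtain ⟨-, -, -, -, -, -, -, -, -, -, -, hnW, -, -, -, -, -, -⟩ := hV.facts
  obtain ⟨⟨hs, hk₀, hkμ, hw1, hw2, he1, he2, hε1, hε2⟩, ⟨hrB1, hrB2, hrW1, hrW2, hm, hN, hn, hμn, hR₀, hR₀n⟩,
    ⟨hko1, hko2, hkc1, hkc2, hLB, hLW, hWB, hWW⟩, ⟨h81, h82, h41, h42, h641, h642⟩, ⟨-, -, -, -, -, -, ht1, ht2, -, -⟩⟩ := ifacts hV hσ hadm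
  -- the target row is a decision-laden atom: replace it by a variable before any arithmetic
  generalize σ.tgo P = tg at hvP hout ht1 ht2
  have f1 : 2 * P.e ≤ P.rW := by clear * - hrW2 hm hμn hs hkμ he1 hn; omega
  have f2 : 16 ≤ P.n := by clear * - hn; omega
  have f3 : P.n / 8 ≤ P.WB := by clear * - hWB hrB2 hm hμn hs hkμ; omega
  have f4 : 2 * (P.e : ℤ) < ((P.n / 4 : ℕ) : ℤ) - (P.n / 8 : ℕ) - (P.n / 64 : ℕ) := by clear * - he1 hkμ hμn hn; omega
  have f5 : 1 ≤ P.s := by clear * - hs hk₀; omega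
  have f6 : (P.e : ℤ) < P.s := by clear * - hs he1 hk₀; omega
  have htr : -(P.rW : ℤ) ≤ tg - (P.n / 64 : ℕ) := by clear * - hrW2 hm hμn hs hkμ ht1 hn; omega
  exact ringTube_disjoint_neg_tgtSet hnW1 ⟨_, by rw [← hnW, mul_comm]⟩ f1 hg f2 f3 ⟨ht1, ht2⟩ f4 f5 f6 htr hout huT
    (by rw [neg_neg]; exact hvP)

/-- **The private supports of the two colours are disjoint** for a valid rung and a slot in range,
admissible and separated. [cite: Nolin2008, §4.3 Lemma 13 (arXiv 0711.4948: Lemma 12, disjoint supports `𝒜⁺`, `𝒜⁻`)] -/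
theorem disjoint_Pfin_Mfin (hV : P.Valid) (hK : 1 ≤ P.K) (hσ : σ.InRange P) (hadm : σ.Admissible P) (hsep : σ.SepOK P) :
    Disjoint (σ.Pfin P) (σ.Mfin P) := by
  obtain ⟨⟨hs, hk₀, hkμ, hw1, hw2, he1, he2, hε1, hε2⟩, ⟨hrB1, hrB2, hrW1, hrW2, hm, hN, hn, hμn, hR₀, hR₀n⟩,
    ⟨hko1, hko2, hkc1, hkc2, hLB, hLW, hWB, hWW⟩, -, -⟩ := ifacts hV hσ hadm
  have hμ32 := mu_ge (P := P) hK
  rw [Finset.disjoint_left]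
  intro v hvP hvM
  rw [Pfin, ← Finset.mem_coe, coe_corrFin] at hvP
  rw [Mfin, Finset.mem_image] at hvM
  obtain ⟨u, hu, huv⟩ := hvM
  have hvu : u = -v := by rw [← huv, neg_neg]
  subst hvu
  rw [← Finset.mem_coe, coe_corrFin] at hu
  rcases hvP with (hvP | hvP) | hvP <;> rcases hu with (hu | hu) | hu
  · exact sep_near_near hV hσ hadm hsep hvP hu
  · have h1 := norm_blackNear hV hσ hadm hvP; have h2 := norm_whiteArc hV hσ hadm hu; rw [triNorm_neg] at h2
    clear * - h1 h2 hrW1 hLB hko2 hs he1 hμ32 hk₀; omega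
  · have h1 := norm_blackNear hV hσ hadm hvP; have h2 := norm_whiteTgt hV hσ hadm hu; rw [triNorm_neg] at h2
    clear * - h1 h2 hrW1 hLB hko2 hs he1 hμ32 hk₀; omega
  · exact sep_arcB_nearW hV hσ hadm hvP hu
  · have h1 := norm_blackArc hV hσ hadm hvP; have h2 := norm_whiteArc hV hσ hadm hu; rw [triNorm_neg] at h2
    clear * - h1 h2 hrB2 hrW1 hs he1 hμ32 hk₀; omega
  · have h1 := norm_blackArc hV hσ hadm hvP; have h2 := norm_whiteTgt hV hσ hadm hu; rw [triNorm_neg] at h2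
    clear * - h1 h2 hrB2 hrW1 hs he1 hμ32 hk₀; omega
  · exact sep_tgtB_nearW hV hσ hadm hvP hu
  · exact sep_tgtB_arcW hV hσ hadm hvP hu
  · have h1 := norm_blackTgt hV hσ hadm hvP; have h2 := norm_whiteTgt hV hσ hadm hu; simp only [Pi.neg_apply] at h2
    clear * - h1 h2; omega

/-- **The shared support is disjoint from the private supports** (all private sites lie in `Λ̊_m`). [cite: Nolin2008, §4.3 Lemma 13 (arXiv 0711.4948: Lemma 12)] -/
theorem disjoint_shared (hV : P.Valid) (hσ : σ.InRange P) (hadm : σ.Admissible P) (R : ℕ) :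
    Disjoint (sharedFin P.m R) (σ.Pfin P) ∧ Disjoint (sharedFin P.m R) (σ.Mfin P) := by
  obtain ⟨⟨hs, hk₀, hkμ, hw1, hw2, he1, he2, hε1, hε2⟩, ⟨hrB1, hrB2, hrW1, hrW2, hm, hN, hn, hμn, hR₀, hR₀n⟩,
    ⟨hko1, hko2, hkc1, hkc2, hLB, hLW, hWB, hWW⟩, -, -⟩ := ifacts hV hσ hadm
  constructor
  · rw [Finset.disjoint_left]
    intro v hv hv'
    rw [mem_sharedFin] at hv
    rw [← Finset.mem_coe, Pfin, coe_corrFin] at hv'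
    rcases hv' with (hv' | hv') | hv'
    · have := norm_blackNear hV hσ hadm hv'; clear * - hv this; omega
    · have := norm_blackArc hV hσ hadm hv'; clear * - hv this hrB1 he1 hkμ hk₀; omega
    · have := norm_blackTgt hV hσ hadm hv'; clear * - hv this hrB1 he1 hkμ hk₀; omega
  · rw [Finset.disjoint_left]
    intro v hv hv'
    rw [mem_sharedFin] at hv
    rw [Mfin, Finset.mem_image] at hv'
    obtain ⟨u, hu, rfl⟩ := hv'
    rw [triNorm_neg] at hv
    rw [← Finset.mem_coe, coe_corrFin] at hu
    rcases hu with (hu | hu) | hu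
    · have := norm_whiteNear hV hσ hadm hu; clear * - hv this; omega
    · have := norm_whiteArc hV hσ hadm hu; clear * - hv this hrW1 he1 hkμ hk₀; omega
    · have := norm_whiteTgt hV hσ hadm hu; clear * - hv this hrW1 he1 hkμ hk₀; omega

end Slot

end Literature.Probability.Percolation
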